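import Literature.Probability.LatticeModels.SiteBurtonKeane
import Literature.Probability.LatticeModels.StarCrossing
import HarnessLib

/-!
# Burton–Keane uniqueness of the infinite `∗`-cluster of constant spin (periodic finite-energy measures)

Topic `Probability/LatticeModels`. Georgii–Higuchi 2000 use uniqueness of infinite clusters both for
the nearest-neighbour clusters and for the `∗`-clusters of `ℤ²` (§4, Lemma 4.1: "at most one
infinite `+` (resp. `+∗`) cluster"; Cor. 3.3), always through the Burton–Keane theorem for periodic
measures with finite energy (proof of Lemma 3.1, Step 2). `SiteBurtonKeane.lean` proved the
nearest-neighbour case; here the same argument is run for the `s`-clusters of an **arbitrary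
translation-covariant, locally finite, range-one graph `G ⊇ 𝕃^d` on `ℤ^d`** (the cut-ball counting
of Bollobás–Riordan 2006, Ch. 5, Thm. 4 only uses that neighbours of a box lie in the next box and
that boxes are connected), and specialised to the `∗`-graph of `ℤ²`:

* `cutBallOf G c r`, `card_filter_cutBallOf_le` — the cut-ball event for `G` and the deterministic
  counting bound (hubs of the open graph in `Λ_{n+1}`, `IsCutSet.isHub`, `card_add_two_le_card_of_isHub`);
* `ae_numInfiniteClusters_spinBonds_le_one_of_graph` — for `μ` invariant and ergodic under `2ℤ^d`
  with the finite energy property, a.s. at most one infinite `s`-cluster of `G`;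
* `starShiftIso`, **`ae_starCluster_unique`** — the case `G = zdStarGraph`: a.s. any two sites of
  `ℤ²` with infinite `s∗`-clusters are joined by a `∗`-path of `s`-sites.

## References

* H.-O. Georgii, Y. Higuchi, J. Math. Phys. 41 (2000), proof of Lemma 3.1, Step 2 (p. 7); §4
  (Lemma 4.1: uniqueness for `∗`clusters) [GeorgiiHiguchi2000].
* B. Bollobás, O. Riordan, *Percolation*, CUP 2006, Ch. 5, Lemma 2 and Thm. 4 [BollobasRiordan2006].
* R. M. Burton, M. Keane, Comm. Math. Phys. 121 (1989) 501–505 [BurtonKeane1989].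
-/

noncomputable section

open MeasureTheory Filter Finset SimpleGraph
open Literature.Probability.Percolation
open scoped ENNReal

namespace Literature.Probability.LatticeModels

variable {d : ℕ}

/-! ### Range-one graphs on `ℤ^d` containing the lattice -/

section Graph

variable (G : SimpleGraph (Site d)) [G.LocallyFinite]

/-- The **cut-ball event for the graph `G`**: `Λ_r(c)` is a cut set of the bond configuration
(Bollobás–Riordan 2006, Ch. 5, proof of Thm. 4, `T_r(x)`; `cutBall` is the case `G = 𝕃^d`). [cite: BollobasRiordan2006, Ch. 5, proof of Thm. 4 (p. 107, the event T_r(x))] -/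
def cutBallOf (c : Site d) (r : ℕ) : Set (BondConfig (Site d)) :=
  {ω | IsCutSet G (shiftedBox c r) ω}

variable {G}

/-- The cut-ball event is measurable (as for `cutBall`). [folklore] -/
theorem measurableSet_cutBallOf (c : Site d) (r : ℕ) : MeasurableSet (cutBallOf G c r) := by
  set K := shiftedBox c r with hK
  set S : SimpleGraph (Site d) := withinGraph ⊤ (↑K : Set (Site d))ᶜ with hS
  have heq : cutBallOf G c r = {ω | (↑(edgesIn G K) : Set (Sym2 (Site d))) ⊆ ω} ∩
      ⋃ w : Fin 3 → Site d, ((⋂ i, {_ω | w i ∉ K}) ∩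
        (⋂ i, ⋃ k ∈ K, {ω : BondConfig (Site d) | s(k, w i) ∈ ω ∧ k ≠ w i}) ∩
        (⋂ i, ⋂ j, {_ω | i = j} ∪ (openConnVia S (w i) (w j))ᶜ) ∩
        (⋂ i, percolatesVia S (w i))) := by
    ext ω
    simp only [cutBallOf, Set.mem_setOf_eq, Set.mem_inter_iff, Set.mem_iUnion, Set.mem_iInter,
      Set.mem_union, Set.mem_compl_iff, exists_prop]
    constructor
    · rintro ⟨h1, w, h2, h3, h4, h5⟩
      refine ⟨h1, w, ⟨⟨h2, fun i => ?_⟩, fun i j => ?_⟩, h5⟩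
      · obtain ⟨k, hk, hadj⟩ := h3 i
        rw [openGraph_adj] at hadj
        exact ⟨k, hk, hadj⟩
      · by_cases hij : i = j
        · exact Or.inl hij
        · exact Or.inr fun h => hij (h4 i j h)
    · rintro ⟨h1, w, ⟨⟨h2, h3⟩, h4⟩, h5⟩
      refine ⟨h1, w, h2, fun i => ?_, fun i j h => ?_, h5⟩
      · obtain ⟨k, hk, hadj⟩ := h3 i
        refine ⟨k, hk, ?_⟩
        rw [openGraph_adj]; exact hadj
      · rcases h4 i j with hij | hij
        · exact hij
        · exact absurd h hij
  rw [heq]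
  refine (measurableSet_setOf_subset (Finset.countable_toSet _)).inter
    (MeasurableSet.iUnion fun w => (((MeasurableSet.iInter fun i => MeasurableSet.const _).inter
      (MeasurableSet.iInter fun i => MeasurableSet.biUnion (Finset.countable_toSet _)
        fun k _ => (measurableSet_mem _).inter (MeasurableSet.const _))).inter
      (MeasurableSet.iInter fun i => MeasurableSet.iInter fun j => (MeasurableSet.const _).union
        (measurableSet_openConnVia S (w i) (w j)).compl)).inter
      (MeasurableSet.iInter fun i => measurableSet_percolatesVia S (w i)))

/-- Translating a configuration along an automorphism of `G` acting as `x ↦ x + v` carries the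
cut-ball event at `c` into the cut-ball event at `c + v`. [folklore] -/
theorem cutBallOf_subset_preimage_shift (φ : G ≃g G) {v : Site d} (hφ : ∀ x, φ x = x + v)
    (c : Site d) (r : ℕ) :
    cutBallOf G c r ⊆ BondConfig.relabel (sym2Equiv (Site.shift v)) ⁻¹' cutBallOf G (c + v) r := by
  intro ω hω
  have h := IsCutSet.image φ hω
  have hbox : (shiftedBox c r).image φ = shiftedBox (c + v) r := by
    rw [← shiftedBox_image_add]
    exact Finset.image_congr fun x _ => hφ x
  have hφe : φ.toEquiv = Site.shift v := Equiv.ext hφ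
  rw [hbox, hφe] at h
  exact h

omit [G.LocallyFinite] in
/-- Neighbours in a range-one graph of a site of `Λ_n` lie in `Λ_{n+1}`. [folklore] -/
theorem mem_box_succ_of_adj_of_range_one (hsup : ∀ x y, G.Adj x y → ∀ i, |x i - y i| ≤ 1)
    {n : ℕ} {x y : Site d} (hx : x ∈ box d n) (h : G.Adj x y) : y ∈ box d (n + 1) := by
  rw [mem_box] at hx ⊢
  intro i
  have h1 := hsup x y h i
  have h2 := hx i
  rw [abs_le] at h1
  push_cast
  omega

/-- For a range-one graph, the inner boundary of a box is contained in the lattice inner boundary. [folklore] -/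
theorem innerBoundary_box_subset_of_range_one (hsup : ∀ x y, G.Adj x y → ∀ i, |x i - y i| ≤ 1)
    (n : ℕ) : innerBoundary G (box d n) ⊆ innerBoundary (zdGraph d) (box d n) := by
  intro x hx
  rw [mem_innerBoundary_iff] at hx ⊢
  obtain ⟨hxbox, y, hy, hadj⟩ := hx
  refine ⟨hxbox, ?_⟩
  rw [mem_box] at hxbox hy
  push Not at hy
  obtain ⟨i, hi⟩ := hy
  have h1 := hsup x y hadj i
  have h2 := hxbox i
  rw [abs_le] at h1
  by_cases hxi : x i = n
  · refine ⟨x + Pi.single i 1, ?_, ?_⟩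
    · have hv : (x + Pi.single i 1 : Site d) i = (n : ℤ) + 1 := by simp [hxi]
      rw [mem_box]; push Not
      refine ⟨i, fun _ => ?_⟩
      rw [hv]; omega
    · rw [zdGraph_adj_iff]; exact ⟨i, Or.inl rfl⟩
  · have hxi' : x i = -n := by omega
    refine ⟨x - Pi.single i 1, ?_, ?_⟩
    · have hv : (x - Pi.single i 1 : Site d) i = -(n : ℤ) - 1 := by simp [hxi']
      rw [mem_box]; push Not
      refine ⟨i, fun h => ?_⟩
      rw [hv] at h; omega
    · rw [zdGraph_adj_iff]; exact ⟨i, Or.inr (by simp)⟩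

open Classical in
/-- **Deterministic bound on the number of cut-balls for a range-one graph containing the lattice**
(Bollobás–Riordan 2006, Ch. 5, pp. 108–109, as `card_filter_cutBall_le`): the cut-balls with
centres in `(2r+2)Λ_m` are pairwise disjoint hubs of the open graph of `Λ_{n+1}` relative to the
inner boundary, `n = (2r+2)m + r`, whence their number is at most `|∂ⁱⁿΛ_{n+1}|`. [cite: BollobasRiordan2006, Ch. 5, proof of Thm. 4 (pp. 108–109)] -/
theorem card_filter_cutBallOf_le (hsup : ∀ x y, G.Adj x y → ∀ i, |x i - y i| ≤ 1)
    (hnn : zdGraph d ≤ G) (r m : ℕ) {ω : BondConfig (Site d)} (hωG : ω ⊆ G.edgeSet) :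
    ((centres r m).filter fun c => ω ∈ cutBallOf G c r).card ≤
      (innerBoundary (zdGraph d) (box d ((2 * r + 2) * m + r + 1))).card := by
  classical
  set n := (2 * r + 2) * m + r with hn
  set Wc := (centres r m).filter fun c => ω ∈ cutBallOf G c r with hWc
  set 𝓚 : Finset (Finset (Site d)) := Wc.image fun c => shiftedBox c r with h𝓚
  have hcard : 𝓚.card = Wc.card := Finset.card_image_of_injective _ (shiftedBox_injective r)
  rcases Wc.eq_empty_or_nonempty with hW | hW
  · rw [hW]; simp
  have hne : 𝓚.Nonempty := by rwa [h𝓚, Finset.image_nonempty]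
  rw [← hcard]
  refine le_trans (Nat.le_add_right _ 2) ((card_add_two_le_card_of_isHub
    (withinGraph (openGraph ω) ↑(box d (n + 1))) _ 𝓚 hne ?_ ?_).trans
    (Finset.card_le_card (innerBoundary_box_subset_of_range_one hsup (n + 1))))
  · intro K hK K' hK' hKK'
    obtain ⟨c, hc, rfl⟩ := Finset.mem_image.1 hK
    obtain ⟨c', hc', rfl⟩ := Finset.mem_image.1 hK'
    obtain ⟨j, -, rfl⟩ := Finset.mem_image.1 (Finset.mem_filter.1 hc).1
    obtain ⟨j', -, rfl⟩ := Finset.mem_image.1 (Finset.mem_filter.1 hc').1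
    exact disjoint_shiftedBox_of_ne fun h => hKK' (by rw [h])
  · intro K hK
    obtain ⟨c, hc, rfl⟩ := Finset.mem_image.1 hK
    obtain ⟨hcW, hcut⟩ := Finset.mem_filter.1 hc
    have hcbox : c ∈ box d ((2 * r + 2) * m) := centres_subset_box r m hcW
    have hKn : shiftedBox c r ⊆ box d n := fun x hx =>
      image_add_box_subset hcbox (Finset.mem_image.2 ⟨x - c, mem_shiftedBox_iff.1 hx, sub_add_cancel x c⟩)
    refine IsCutSet.isHub hcut hωG ⟨c, self_mem_shiftedBox c r⟩
      (hKn.trans (box_mono d (Nat.le_succ n))) (fun k hk v hkv => ?_) (fun x hx y hy => ?_)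
    · exact mem_box_succ_of_adj_of_range_one hsup (hKn hk) hkv
    · exact (shiftedBox_reachable c r hx hy).mono (withinGraph_mono_left hnn _)

/-- **The Burton–Keane contradiction for `G`** (as `false_of_real_cutBall_pos`): positive cut-ball
probability, monotone under the even translates, and the counting bound are incompatible. [cite: BollobasRiordan2006, Ch. 5, Thm. 4 (pp. 107–109)] -/
theorem false_of_real_cutBallOf_pos (hsup : ∀ x y, G.Adj x y → ∀ i, |x i - y i| ≤ 1)
    (hnn : zdGraph d ≤ G) {ν : Measure (BondConfig (Site d))} [IsProbabilityMeasure ν]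
    (hd : 1 ≤ d) (r : ℕ) (hG : ∀ᵐ ω ∂ν, ω ⊆ G.edgeSet)
    (hshift : ∀ m, ∀ c ∈ centres (d := d) r m, ν.real (cutBallOf G 0 r) ≤ ν.real (cutBallOf G c r))
    (ha : 0 < ν.real (cutBallOf G (0 : Site d) r)) : False := by
  classical
  set a := ν.real (cutBallOf G (0 : Site d) r) with ha_def
  have hsum : ∀ m : ℕ, ∑ c ∈ centres r m, ν (cutBallOf G c r) ≤
      (innerBoundary (zdGraph d) (box d ((2 * r + 2) * m + r + 1))).card := by
    intro m
    set L := innerBoundary (zdGraph d) (box d ((2 * r + 2) * m + r + 1)) with hL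
    have h1 : ∑ c ∈ centres r m, ν (cutBallOf G c r) =
        ∫⁻ ω, ∑ c ∈ centres r m, (cutBallOf G c r).indicator 1 ω ∂ν := by
      rw [lintegral_finsetSum _ fun c _ => measurable_one.indicator (measurableSet_cutBallOf c r)]
      exact Finset.sum_congr rfl fun c _ => (lintegral_indicator_one (measurableSet_cutBallOf c r)).symm
    calc ∑ c ∈ centres r m, ν (cutBallOf G c r)
          = ∫⁻ ω, ∑ c ∈ centres r m, (cutBallOf G c r).indicator 1 ω ∂ν := h1
      _ ≤ ∫⁻ _ω, (L.card : ℝ≥0∞) ∂ν := by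
          refine lintegral_mono_ae ?_
          filter_upwards [hG] with ω hω
          have hs : ∑ c ∈ centres r m, (cutBallOf G c r).indicator (1 : BondConfig (Site d) → ℝ≥0∞) ω =
              (((centres r m).filter fun c => ω ∈ cutBallOf G c r).card : ℝ≥0∞) := by
            simp only [Set.indicator_apply, Pi.one_apply]
            rw [Finset.sum_boole]
          rw [hs]
          exact_mod_cast card_filter_cutBallOf_le hsup hnn r m hω
      _ = L.card := by rw [lintegral_const, measure_univ, mul_one]
  set C₀ : ℕ := 2 * d * (2 * r + 3) ^ (d - 1) with hC₀
  obtain ⟨m, hm⟩ := exists_nat_gt ((C₀ : ℝ) / a)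
  have hm' : (C₀ : ℝ) < a * (2 * m + 1) := by
    rw [div_lt_iff₀ ha] at hm
    nlinarith
  set n := (2 * r + 2) * m + r with hn
  set L := innerBoundary (zdGraph d) (box d (n + 1)) with hL
  have hlow : ((2 * m + 1 : ℝ)) ^ d * a ≤ ∑ c ∈ centres r m, ν.real (cutBallOf G c r) := by
    calc ((2 * m + 1 : ℝ)) ^ d * a = ∑ _c ∈ centres (d := d) r m, a := by
          rw [Finset.sum_const, card_centres, nsmul_eq_mul]; push_cast; ring
      _ ≤ ∑ c ∈ centres r m, ν.real (cutBallOf G c r) :=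
          Finset.sum_le_sum fun c hc => hshift m c hc
  have hup : ∑ c ∈ centres r m, ν.real (cutBallOf G c r) ≤ (L.card : ℝ) := by
    have h' := hsum m
    have hs : ∑ c ∈ centres r m, ν.real (cutBallOf G c r) =
        (∑ c ∈ centres r m, ν (cutBallOf G c r)).toReal := by
      rw [ENNReal.toReal_sum fun c _ => measure_ne_top _ _]
      rfl
    rw [hs]
    have := ENNReal.toReal_mono (ENNReal.natCast_ne_top L.card) h'
    simpa using this
  have hLcard : (L.card : ℝ) ≤ C₀ * (2 * m + 1 : ℝ) ^ (d - 1) := by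
    have h1 := card_innerBoundary_box_le (d := d) (n + 1)
    have h2 : 2 * (n + 1) + 1 ≤ (2 * r + 3) * (2 * m + 1) := by
      have : (2 * r + 3) * (2 * m + 1) = 2 * (n + 1) + 1 + 2 * m := by rw [hn]; ring
      omega
    calc (L.card : ℝ) ≤ ((2 * d * (2 * (n + 1) + 1) ^ (d - 1) : ℕ) : ℝ) := by exact_mod_cast h1
      _ ≤ ((2 * d * ((2 * r + 3) * (2 * m + 1)) ^ (d - 1) : ℕ) : ℝ) := by
          exact_mod_cast Nat.mul_le_mul_left _ (Nat.pow_le_pow_left h2 _)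
      _ = C₀ * (2 * m + 1 : ℝ) ^ (d - 1) := by rw [hC₀]; push_cast; rw [mul_pow]; ring
  have hpow : (2 * m + 1 : ℝ) ^ d = (2 * m + 1) * (2 * m + 1) ^ (d - 1) := by
    conv_lhs => rw [← Nat.sub_add_cancel hd, pow_succ]
    ring
  have hchain := hlow.trans (hup.trans hLcard)
  rw [hpow] at hchain
  have hpos : (0 : ℝ) < (2 * m + 1) ^ (d - 1) := by positivity
  have key : (2 * m + 1 : ℝ) * a ≤ C₀ := by
    have h' : ((2 * m + 1 : ℝ) * a) * (2 * m + 1) ^ (d - 1) ≤ (C₀ : ℝ) * (2 * m + 1) ^ (d - 1) := by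
      linarith [hchain]
    exact le_of_mul_le_mul_right h' hpos
  linarith [key, hm']

end Graph

/-! ### The theorem for periodic finite-energy spin measures and a covariant range-one graph -/

section Periodic

variable {G : SimpleGraph (Site d)} [G.LocallyFinite]
variable {μ : Measure (SpinConfig (Site d))} [IsProbabilityMeasure μ]

omit [G.LocallyFinite] [IsProbabilityMeasure μ] in
/-- Invariance under `2ℤ^d` transports to the bond configuration of the `s`-clusters of `G`. [cite: GeorgiiHiguchi2000, Lemma 3.1 (proof, Step 2, p. 7)] -/
theorem measure_preimage_spinBonds_relabel_of_even_of_graph (shiftIso : Site d → G ≃g G)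
    (hshiftIso : ∀ v x, shiftIso v x = x + v) (s : ℤˣ)
    (hinv : ∀ v : Site d, μ.map (configRelabel (Site.shift ((2 : ℤ) • v))) = μ)
    {c : Site d} (hc : ∃ v : Site d, c = (2 : ℤ) • v) {S : Set (BondConfig (Site d))}
    (hS : MeasurableSet S) :
    μ (spinBonds G s ⁻¹' (BondConfig.relabel (sym2Equiv (Site.shift c)) ⁻¹' S)) =
      μ (spinBonds G s ⁻¹' S) := by
  obtain ⟨v, rfl⟩ := hc
  have hΦ : Measurable (spinBonds G s) := measurable_spinBonds s
  have hφe : (shiftIso ((2 : ℤ) • v)).toEquiv = Site.shift ((2 : ℤ) • v) := Equiv.ext (hshiftIso _)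
  have heq : spinBonds G s ⁻¹' (BondConfig.relabel (sym2Equiv (Site.shift ((2 : ℤ) • v))) ⁻¹' S) =
      (configRelabel (Site.shift ((2 : ℤ) • v))) ⁻¹' (spinBonds G s ⁻¹' S) := by
    ext ω
    simp only [Set.mem_preimage]
    rw [← hφe, spinBonds_configRelabel]
  rw [heq, ← Measure.map_apply (configRelabel _).measurable (hΦ hS), hinv v]

/-- **No three infinite `s`-clusters of `G`** for a `2ℤ^d`-invariant finite-energy `μ`, `d ≥ 1`. [cite: BollobasRiordan2006, Ch. 5, Thm. 4 (pp. 107–109)] -/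
theorem measure_preimage_spinBonds_threeInfClusters_eq_zero_of_graph (shiftIso : Site d → G ≃g G)
    (hshiftIso : ∀ v x, shiftIso v x = x + v) (hsup : ∀ x y, G.Adj x y → ∀ i, |x i - y i| ≤ 1)
    (hnn : zdGraph d ≤ G) (hd : 1 ≤ d) (s : ℤˣ)
    (hinv : ∀ v : Site d, μ.map (configRelabel (Site.shift ((2 : ℤ) • v))) = μ)
    (hfe : ∀ (N : ℕ) (S : Set (SpinConfig (Site d))), MeasurableSet S →
      μ {ω | glueWith (box d N) (fun _ => s) ω ∈ S} ≠ 0 → μ S ≠ 0) :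
    μ (spinBonds G s ⁻¹' threeInfClusters (Site d)) = 0 := by
  classical
  have hΦ : Measurable (spinBonds G s) := measurable_spinBonds s
  by_contra h3
  obtain ⟨r, hr⟩ : ∃ r, μ (spinBonds G s ⁻¹' threeInBox (d := d) r) ≠ 0 := by
    by_contra hall
    push Not at hall
    refine h3 (measure_mono_null (Set.preimage_mono threeInfClusters_subset_iUnion) ?_)
    rw [Set.preimage_iUnion]
    exact measure_iUnion_null_iff.2 hall
  have hcb : μ (spinBonds G s ⁻¹' cutBallOf G (0 : Site d) r) ≠ 0 := by
    refine hfe r _ (hΦ (measurableSet_cutBallOf 0 r)) fun h0 => hr (measure_mono_null ?_ h0)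
    rintro ω ⟨x, hxbox, hperc, hdis⟩
    change IsCutSet G (shiftedBox 0 r) _
    rw [shiftedBox_zero]
    exact isCutSet_spinBonds_glueWith hxbox hperc hdis
  set ν : Measure (BondConfig (Site d)) := μ.map (spinBonds G s) with hν
  haveI : IsProbabilityMeasure ν := Measure.isProbabilityMeasure_map hΦ.aemeasurable
  have hνapp : ∀ {S : Set (BondConfig (Site d))}, MeasurableSet S →
      ν S = μ (spinBonds G s ⁻¹' S) := fun hS => Measure.map_apply hΦ hS
  refine false_of_real_cutBallOf_pos hsup hnn (ν := ν) hd r ?_ (fun m c hc => ?_) ?_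
  · rw [hν, ae_map_iff hΦ.aemeasurable (measurableSet_setOf_subset_right _)]
    exact Eventually.of_forall fun ω => spinBonds_subset_edgeSet s ω
  · simp only [measureReal_def]
    rw [hνapp (measurableSet_cutBallOf 0 r), hνapp (measurableSet_cutBallOf c r)]
    refine ENNReal.toReal_mono (measure_ne_top _ _) ?_
    calc μ (spinBonds G s ⁻¹' cutBallOf G 0 r)
        ≤ μ (spinBonds G s ⁻¹'
            (BondConfig.relabel (sym2Equiv (Site.shift c)) ⁻¹' cutBallOf G c r)) := by
          refine measure_mono (Set.preimage_mono ?_)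
          simpa using cutBallOf_subset_preimage_shift (shiftIso c) (hshiftIso c) (0 : Site d) r
      _ = μ (spinBonds G s ⁻¹' cutBallOf G c r) :=
          measure_preimage_spinBonds_relabel_of_even_of_graph shiftIso hshiftIso s hinv
            (centres_eq_two_smul hc) (measurableSet_cutBallOf c r)
  · rw [measureReal_def, hνapp (measurableSet_cutBallOf 0 r), ENNReal.toReal_pos_iff]
    exact ⟨pos_iff_ne_zero.2 hcb, measure_lt_top _ _⟩

omit [G.LocallyFinite] [IsProbabilityMeasure μ] in
/-- The events "exactly one / exactly two infinite `s`-clusters of `G`" are invariant under the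
translations of the spins. [cite: BollobasRiordan2006, Ch. 5, p. 104] -/
theorem preimage_configRelabel_shift_spinBonds_preimage_of_graph (shiftIso : Site d → G ≃g G)
    (hshiftIso : ∀ v x, shiftIso v x = x + v) (s : ℤˣ) (v : Site d)
    {E : Set (BondConfig (Site d))}
    (hE : BondConfig.relabel (sym2Equiv (Site.shift v)) ⁻¹' E = E) :
    (configRelabel (Site.shift v)) ⁻¹' (spinBonds G s ⁻¹' E) = spinBonds G s ⁻¹' E := by
  ext ω
  simp only [Set.mem_preimage]
  have hφe : (shiftIso v).toEquiv = Site.shift v := Equiv.ext (hshiftIso _)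
  rw [← hφe, spinBonds_configRelabel]
  conv_rhs => rw [← hE, ← hφe]
  rfl

/-- **Not exactly two infinite `s`-clusters of `G`** for a `2ℤ^d`-ergodic finite-energy `μ`. [cite: BollobasRiordan2006, Ch. 5, Lemma 2 (pp. 105–106)] -/
theorem measure_preimage_spinBonds_exactlyTwoInfClusters_eq_zero_of_graph (shiftIso : Site d → G ≃g G)
    (hshiftIso : ∀ v x, shiftIso v x = x + v) (hnn : zdGraph d ≤ G) (s : ℤˣ)
    (herg : ∀ A : Set (SpinConfig (Site d)), MeasurableSet A →
      (∀ v : Site d, (configRelabel (Site.shift ((2 : ℤ) • v))) ⁻¹' A = A) → μ A = 0 ∨ μ A = 1)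
    (hfe : ∀ (N : ℕ) (S : Set (SpinConfig (Site d))), MeasurableSet S →
      μ {ω | glueWith (box d N) (fun _ => s) ω ∈ S} ≠ 0 → μ S ≠ 0) :
    μ (spinBonds G s ⁻¹' exactlyTwoInfClusters (Site d)) = 0 := by
  classical
  have hΦ : Measurable (spinBonds G s) := measurable_spinBonds s
  by_contra h2
  obtain ⟨n, hn⟩ : ∃ n, μ (spinBonds G s ⁻¹' twoInBox (d := d) n) ≠ 0 := by
    by_contra hall
    push Not at hall
    refine h2 (measure_mono_null (Set.preimage_mono exactlyTwoInfClusters_subset_iUnion) ?_)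
    rw [Set.preimage_iUnion]
    exact measure_iUnion_null_iff.2 hall
  have h1 : μ (spinBonds G s ⁻¹' exactlyOneInfCluster (Site d)) ≠ 0 := by
    refine hfe n _ (hΦ measurableSet_exactlyOneInfCluster) fun h0 => hn (measure_mono_null ?_ h0)
    rintro ω ⟨x, y, hx, hy, hpx, hpy, -, hall⟩
    refine spinBonds_glueWith_mem_exactlyOneInfCluster
      (fun a ha b hb => (box_withinGraph_reachable n ha hb).mono (withinGraph_mono_left hnn _))
      ⟨x, hpx⟩ fun z hz => ?_
    rcases hall z hz with h | h
    · exact ⟨x, hx, h⟩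
    · exact ⟨y, hy, h⟩
  have hI1 : μ (spinBonds G s ⁻¹' exactlyOneInfCluster (Site d)) = 1 := by
    rcases herg _ (hΦ measurableSet_exactlyOneInfCluster) (fun v =>
      preimage_configRelabel_shift_spinBonds_preimage_of_graph shiftIso hshiftIso s _
        (preimage_relabel_exactlyOneInfCluster (Site.shift ((2 : ℤ) • v)))) with h | h
    · exact absurd h h1
    · exact h
  have hI2 : μ (spinBonds G s ⁻¹' exactlyTwoInfClusters (Site d)) = 1 := by
    rcases herg _ (hΦ measurableSet_exactlyTwoInfClusters) (fun v =>
      preimage_configRelabel_shift_spinBonds_preimage_of_graph shiftIso hshiftIso s _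
        (preimage_relabel_exactlyTwoInfClusters (Site.shift ((2 : ℤ) • v)))) with h | h
    · exact absurd h h2
    · exact h
  have hdisj : Disjoint (spinBonds G s ⁻¹' exactlyOneInfCluster (Site d))
      (spinBonds G s ⁻¹' exactlyTwoInfClusters (Site d)) :=
    disjoint_exactlyOne_exactlyTwo.preimage _
  have hunion : μ (spinBonds G s ⁻¹' exactlyOneInfCluster (Site d) ∪
      spinBonds G s ⁻¹' exactlyTwoInfClusters (Site d)) = 2 := by
    rw [measure_union hdisj (hΦ measurableSet_exactlyTwoInfClusters), hI1, hI2, one_add_one_eq_two]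
  have hle := prob_le_one (μ := μ)
    (s := spinBonds G s ⁻¹' exactlyOneInfCluster (Site d) ∪ spinBonds G s ⁻¹' exactlyTwoInfClusters (Site d))
  rw [hunion] at hle
  exact absurd hle (not_le.2 ENNReal.one_lt_two)

/-- **Burton–Keane uniqueness of the infinite `s`-cluster of a covariant range-one graph
`G ⊇ 𝕃^d`** for `μ` invariant and ergodic under `2ℤ^d` with the finite energy property
(Georgii–Higuchi 2000, proof of Lemma 3.1, Step 2, and §4 for `∗`clusters). [cite: GeorgiiHiguchi2000, Lemma 3.1 (proof, Step 2, p. 7)] -/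
theorem ae_numInfiniteClusters_spinBonds_le_one_of_graph (shiftIso : Site d → G ≃g G)
    (hshiftIso : ∀ v x, shiftIso v x = x + v) (hsup : ∀ x y, G.Adj x y → ∀ i, |x i - y i| ≤ 1)
    (hnn : zdGraph d ≤ G) (s : ℤˣ)
    (hinv : ∀ v : Site d, μ.map (configRelabel (Site.shift ((2 : ℤ) • v))) = μ)
    (herg : ∀ A : Set (SpinConfig (Site d)), MeasurableSet A →
      (∀ v : Site d, (configRelabel (Site.shift ((2 : ℤ) • v))) ⁻¹' A = A) → μ A = 0 ∨ μ A = 1)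
    (hfe : ∀ (N : ℕ) (S : Set (SpinConfig (Site d))), MeasurableSet S →
      μ {ω | glueWith (box d N) (fun _ => s) ω ∈ S} ≠ 0 → μ S ≠ 0) :
    ∀ᵐ ω ∂μ, numInfiniteClusters (spinBonds G s ω) ≤ 1 := by
  rcases Nat.eq_zero_or_pos d with hd | hd
  · subst hd
    refine Eventually.of_forall fun ω => ?_
    rw [numInfiniteClusters_le_one_iff]
    intro x y hx
    exact absurd hx (Set.not_infinite.2 (Set.toFinite _))
  · rw [ae_iff]
    refine measure_mono_null (fun ω hω => mem_union_of_not_numInfiniteClusters_le_one hω) ?_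
    exact measure_union_null
      (measure_preimage_spinBonds_exactlyTwoInfClusters_eq_zero_of_graph shiftIso hshiftIso hnn s herg hfe)
      (measure_preimage_spinBonds_threeInfClusters_eq_zero_of_graph shiftIso hshiftIso hsup hnn hd s
        hinv hfe)

end Periodic

/-! ### The `∗`-graph of `ℤ²` -/

section Star

/-- The translations of `ℤ²` are automorphisms of the `∗`-graph. [cite: GeorgiiHiguchi2000, §2 p. 3] -/
def starShiftIso (v : Site 2) : zdStarGraph ≃g zdStarGraph where
  toEquiv := Site.shift v
  map_rel_iff' := fun {a b} => by
    simp only [Site.shift_apply, zdStarGraph_adj, Pi.add_apply, add_sub_add_right_eq_sub, ne_eq,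
      add_left_inj]

/-- `starShiftIso v x = x + v`. [folklore] -/
@[simp] theorem starShiftIso_apply (v x : Site 2) : starShiftIso v x = x + v := rfl

/-- The `∗`-graph has range one. [folklore] -/
theorem zdStarGraph_range_one (x y : Site 2) (h : zdStarGraph.Adj x y) (i : Fin 2) :
    |x i - y i| ≤ 1 := h.2 i

variable {μ : Measure (SpinConfig (Site 2))} [IsProbabilityMeasure μ]

/-- **Burton–Keane uniqueness of the infinite `s∗`-cluster** (Georgii–Higuchi 2000, §4, Lemma 4.1 /
proof of Lemma 3.1, Step 2, for `∗`clusters): for `μ` on `{±1}^{ℤ²}` invariant and ergodic under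
`2ℤ²` with the finite energy property, `μ`-almost surely any two sites with infinite `s∗`-clusters
are joined by a `∗`-path of `s`-sites. [cite: GeorgiiHiguchi2000, Lemma 3.1 (proof, Step 2, p. 7)] -/
theorem ae_starCluster_unique (s : ℤˣ)
    (hinv : ∀ v : Site 2, μ.map (configRelabel (Site.shift ((2 : ℤ) • v))) = μ)
    (herg : ∀ A : Set (SpinConfig (Site 2)), MeasurableSet A →
      (∀ v : Site 2, (configRelabel (Site.shift ((2 : ℤ) • v))) ⁻¹' A = A) → μ A = 0 ∨ μ A = 1)
    (hfe : ∀ (N : ℕ) (S : Set (SpinConfig (Site 2))), MeasurableSet S →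
      μ {ω | glueWith (box 2 N) (fun _ => s) ω ∈ S} ≠ 0 → μ S ≠ 0) :
    ∀ᵐ ω ∂μ, ∀ x y, (siteCluster zdStarGraph (spinSites s ω) x).Infinite →
      (siteCluster zdStarGraph (spinSites s ω) y).Infinite →
        (siteOpenGraph zdStarGraph (spinSites s ω)).Reachable x y := by
  filter_upwards [ae_numInfiniteClusters_spinBonds_le_one_of_graph starShiftIso starShiftIso_apply
    zdStarGraph_range_one zdGraph_le_zdStarGraph s hinv herg hfe] with ω hω
  exact numInfiniteClusters_spinBonds_le_one_iff.1 hω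

end Star

end Literature.Probability.LatticeModels
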